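import Mathlib
import Literature.MathematicalPhysics.MHD.SolovevFluxSurfaceGGJData
import HarnessLib

/-!
# The `g`-structure of the GGJ (8.134) inputs on the Lee–Cerfon / PCF family: which surface integrals depend on
# the free constant `F ≡ g`, how (polynomially or monotonically), and their signs (proved)

Tenth file of the `lcLoop` series (gridfusion-model-5). In `lcGGJData κ F_B R₀ q₀ a g r` (label `Ψ`, Jardin
orientation) the free constant `g = RB_φ` enters only through `Φ′, Φ″ ∝ g`, `σB² = C_s g`, and
`B² = (g² + G)/u` (`G = lcGradSq`, `u = R²`). Of the eight one-dimensional integrals, six are `g`-free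
(`∫w`, `∫∂w/∂r`, `∫(u√u)⁻¹`, `∫lcQKernelDr`, `∫w/G`, `∫w/u`, `∫w/(uG)`) and exactly two are genuinely
`g`-dependent — `∫ u w/(g² + G)` (for `⟨1/B²⟩`) and `∫ u w/((g² + G)G)` (for `⟨1/(B²G)⟩`) — and both are
ANTITONE in `g²` with POSITIVE integrands. This file proves, for every surface `0 < r < R₀/2`:

* `surfaceAverageE_lcLoop_bsqDivGradSq_split` — `⟨B²/G⟩ = g²·∫w/(uG) ÷ ∫w + ∫w/u ÷ ∫w` (affine in `g²`);
* `integral_invBsq_antitone`, `integral_invBsqGradSq_antitone` — `g₁² ≤ g₂² ⇒ ∫uw/(g₂²+G) ≤ ∫uw/(g₁²+G)` and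
  the same for `∫uw/((g²+G)G)` (so on a `g`-interval `[g₀, g₁]` each is bracketed by its endpoint values —
  the device gridfusion-sos-6 uses for «∀ g ≥ g₀» certificates);
* positivity of `∫w/G`, `∫w/(uG)`, `∫w/u`, `∫uw/(g²+G)`, `∫uw/((g²+G)G)` (all integrands continuous and `> 0`).

HONEST FRAMING: exact real analysis about MODEL objects; enclosures are a Bench matter; no stability claim.
Typer/prover: gridfusion-model-5 (g3), 2026-08-27.
-/

noncomputable section

namespace Literature.MathematicalPhysics.MHD.Solovev

open GradShafranov FluxGeometry _root_.Real MeasureTheory intervalIntegral _root_.Set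

section gstructure

variable {R₀ κ FB q₀ r : ℝ} (hR₀ : 0 < R₀) (hκ : 0 < κ) (hFB : 0 < FB) (hq₀ : 0 < q₀)
  (hr : 0 < r) (h2r : 2 * r < R₀)
include hR₀ hκ hFB hq₀ hr h2r

/-- Continuity in `t` of the building blocks `u`, `G = lcGradSq`, `w = lcAvgWeight` (all with `u > 0`). [folklore] -/
private theorem gs_continuous_blocks :
    Continuous (fun t => lcU R₀ r t) ∧ Continuous (fun t => lcGradSq κ FB R₀ q₀ r t)
      ∧ Continuous (fun t => lcAvgWeight κ FB R₀ q₀ r t) := by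
  have hcU : Continuous (fun t => lcU R₀ r t) := by unfold lcU; fun_prop
  have hpos : ∀ t, 0 < lcU R₀ r t := lcU_pos hR₀ hr.le h2r
  refine ⟨hcU, ?_, continuous_lcAvgWeight hR₀ hκ hFB hq₀ hr.le h2r⟩
  rw [continuous_iff_continuousAt]
  intro t
  have hu := hpos t
  unfold lcGradSq
  fun_prop (disch := positivity)

/-- **`⟨B²/|∇Ψ|²⟩` is affine in `g²`:** `⟨B²/G⟩ = g²·(∫w/(uG) ÷ ∫w) + ∫w/u ÷ ∫w`. [cite: Jardin2010, §8.5.4 eq. (8.134)] -/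
theorem surfaceAverageE_lcLoop_bsqDivGradSq_split (g a : ℝ) :
    surfaceAverageE (psiLC κ FB R₀ q₀ a) (lcLoop R₀ κ r) (2 * π)
        (fun R Z => fieldBsq (fun _ => g) (psiLC κ FB R₀ q₀ a) R Z / gradSq (psiLC κ FB R₀ q₀ a) R Z)
      = g ^ 2 * ((∫ t in (0 : ℝ)..(2 * π),
            lcAvgWeight κ FB R₀ q₀ r t / (lcU R₀ r t * lcGradSq κ FB R₀ q₀ r t))
          / ∫ t in (0 : ℝ)..(2 * π), lcAvgWeight κ FB R₀ q₀ r t)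
        + (∫ t in (0 : ℝ)..(2 * π), lcAvgWeight κ FB R₀ q₀ r t / lcU R₀ r t)
          / ∫ t in (0 : ℝ)..(2 * π), lcAvgWeight κ FB R₀ q₀ r t := by
  obtain ⟨hcU, hcG, hcW⟩ := gs_continuous_blocks hR₀ hκ hFB hq₀ hr h2r
  have hposU : ∀ t, 0 < lcU R₀ r t := lcU_pos hR₀ hr.le h2r
  have hposG : ∀ t, 0 < lcGradSq κ FB R₀ q₀ r t := lcGradSq_pos hR₀ hκ hFB hq₀ hr h2r
  rw [surfaceAverageE_lcLoop_bsqDivGradSq hR₀ hκ hFB hq₀ hr h2r g a]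
  have h1 : Continuous fun t => lcAvgWeight κ FB R₀ q₀ r t / (lcU R₀ r t * lcGradSq κ FB R₀ q₀ r t) :=
    hcW.div (hcU.mul hcG) fun t => (mul_pos (hposU t) (hposG t)).ne'
  have h2 : Continuous fun t => lcAvgWeight κ FB R₀ q₀ r t / lcU R₀ r t :=
    hcW.div hcU fun t => (hposU t).ne'
  have hsplit : ∫ t in (0 : ℝ)..(2 * π), (g ^ 2 + lcGradSq κ FB R₀ q₀ r t)
        / (lcU R₀ r t * lcGradSq κ FB R₀ q₀ r t) * lcAvgWeight κ FB R₀ q₀ r t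
      = g ^ 2 * (∫ t in (0 : ℝ)..(2 * π),
            lcAvgWeight κ FB R₀ q₀ r t / (lcU R₀ r t * lcGradSq κ FB R₀ q₀ r t))
        + ∫ t in (0 : ℝ)..(2 * π), lcAvgWeight κ FB R₀ q₀ r t / lcU R₀ r t := by
    rw [← intervalIntegral.integral_const_mul, ← intervalIntegral.integral_add
      ((h1.const_mul _).intervalIntegrable _ _) (h2.intervalIntegrable _ _)]
    refine intervalIntegral.integral_congr fun t _ => ?_
    have hu := hposU t
    have hG := hposG t
    field_simp
  rw [hsplit, add_div, mul_div_assoc]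

/-- `∫₀^{2π} u·w/(g² + G) dt` is ANTITONE in `g²`. [cite: Jardin2010, §8.5.4 eq. (8.134)] -/
theorem integral_invBsq_antitone {g₁ g₂ : ℝ} (hg : g₁ ^ 2 ≤ g₂ ^ 2) :
    ∫ t in (0 : ℝ)..(2 * π), lcU R₀ r t / (g₂ ^ 2 + lcGradSq κ FB R₀ q₀ r t) * lcAvgWeight κ FB R₀ q₀ r t
      ≤ ∫ t in (0 : ℝ)..(2 * π), lcU R₀ r t / (g₁ ^ 2 + lcGradSq κ FB R₀ q₀ r t)
          * lcAvgWeight κ FB R₀ q₀ r t := by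
  obtain ⟨hcU, hcG, hcW⟩ := gs_continuous_blocks hR₀ hκ hFB hq₀ hr h2r
  have hposU : ∀ t, 0 < lcU R₀ r t := lcU_pos hR₀ hr.le h2r
  have hposG : ∀ t, 0 < lcGradSq κ FB R₀ q₀ r t := lcGradSq_pos hR₀ hκ hFB hq₀ hr h2r
  have hposW : ∀ t, 0 < lcAvgWeight κ FB R₀ q₀ r t := lcAvgWeight_pos hR₀ hκ hFB hq₀ hr.le h2r
  have hc : ∀ g : ℝ, Continuous fun t =>
      lcU R₀ r t / (g ^ 2 + lcGradSq κ FB R₀ q₀ r t) * lcAvgWeight κ FB R₀ q₀ r t := fun g =>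
    (hcU.div (continuous_const.add hcG) fun t =>
      (by have := hposG t; positivity : 0 < g ^ 2 + lcGradSq κ FB R₀ q₀ r t).ne').mul hcW
  refine intervalIntegral.integral_mono_on (by positivity) ((hc g₂).intervalIntegrable _ _)
    ((hc g₁).intervalIntegrable _ _) fun t _ => ?_
  have hu := hposU t
  have hG := hposG t
  have hw := hposW t
  apply mul_le_mul_of_nonneg_right _ hw.le
  exact div_le_div_of_nonneg_left hu.le (by positivity) (by linarith)

/-- `∫₀^{2π} u·w/((g² + G)G) dt` is ANTITONE in `g²`. [cite: Jardin2010, §8.5.4 eq. (8.134)] -/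
theorem integral_invBsqGradSq_antitone {g₁ g₂ : ℝ} (hg : g₁ ^ 2 ≤ g₂ ^ 2) :
    ∫ t in (0 : ℝ)..(2 * π), lcU R₀ r t
        / ((g₂ ^ 2 + lcGradSq κ FB R₀ q₀ r t) * lcGradSq κ FB R₀ q₀ r t) * lcAvgWeight κ FB R₀ q₀ r t
      ≤ ∫ t in (0 : ℝ)..(2 * π), lcU R₀ r t
        / ((g₁ ^ 2 + lcGradSq κ FB R₀ q₀ r t) * lcGradSq κ FB R₀ q₀ r t) * lcAvgWeight κ FB R₀ q₀ r t := by
  obtain ⟨hcU, hcG, hcW⟩ := gs_continuous_blocks hR₀ hκ hFB hq₀ hr h2r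
  have hposU : ∀ t, 0 < lcU R₀ r t := lcU_pos hR₀ hr.le h2r
  have hposG : ∀ t, 0 < lcGradSq κ FB R₀ q₀ r t := lcGradSq_pos hR₀ hκ hFB hq₀ hr h2r
  have hposW : ∀ t, 0 < lcAvgWeight κ FB R₀ q₀ r t := lcAvgWeight_pos hR₀ hκ hFB hq₀ hr.le h2r
  have hc : ∀ g : ℝ, Continuous fun t => lcU R₀ r t
      / ((g ^ 2 + lcGradSq κ FB R₀ q₀ r t) * lcGradSq κ FB R₀ q₀ r t) * lcAvgWeight κ FB R₀ q₀ r t :=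
    fun g => (hcU.div ((continuous_const.add hcG).mul hcG) fun t =>
      (by have := hposG t; positivity :
        0 < (g ^ 2 + lcGradSq κ FB R₀ q₀ r t) * lcGradSq κ FB R₀ q₀ r t).ne').mul hcW
  refine intervalIntegral.integral_mono_on (by positivity) ((hc g₂).intervalIntegrable _ _)
    ((hc g₁).intervalIntegrable _ _) fun t _ => ?_
  have hu := hposU t
  have hG := hposG t
  have hw := hposW t
  apply mul_le_mul_of_nonneg_right _ hw.le
  exact div_le_div_of_nonneg_left hu.le (by positivity) (by nlinarith)

/-- The `g`-free integrals `∫w/G`, `∫w/(uG)`, `∫w/u` and the two `g`-dependent ones are POSITIVE.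
[cite: Jardin2010, §8.5.4 eq. (8.134)] -/
theorem integral_ggjBlocks_pos (g : ℝ) :
    0 < ∫ t in (0 : ℝ)..(2 * π), lcAvgWeight κ FB R₀ q₀ r t / lcGradSq κ FB R₀ q₀ r t ∧
    0 < ∫ t in (0 : ℝ)..(2 * π),
        lcAvgWeight κ FB R₀ q₀ r t / (lcU R₀ r t * lcGradSq κ FB R₀ q₀ r t) ∧
    0 < ∫ t in (0 : ℝ)..(2 * π), lcAvgWeight κ FB R₀ q₀ r t / lcU R₀ r t ∧
    0 < ∫ t in (0 : ℝ)..(2 * π),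
        lcU R₀ r t / (g ^ 2 + lcGradSq κ FB R₀ q₀ r t) * lcAvgWeight κ FB R₀ q₀ r t ∧
    0 < ∫ t in (0 : ℝ)..(2 * π), lcU R₀ r t
        / ((g ^ 2 + lcGradSq κ FB R₀ q₀ r t) * lcGradSq κ FB R₀ q₀ r t) * lcAvgWeight κ FB R₀ q₀ r t := by
  obtain ⟨hcU, hcG, hcW⟩ := gs_continuous_blocks hR₀ hκ hFB hq₀ hr h2r
  have hposU : ∀ t, 0 < lcU R₀ r t := lcU_pos hR₀ hr.le h2r
  have hposG : ∀ t, 0 < lcGradSq κ FB R₀ q₀ r t := lcGradSq_pos hR₀ hκ hFB hq₀ hr h2r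
  have hposW : ∀ t, 0 < lcAvgWeight κ FB R₀ q₀ r t := lcAvgWeight_pos hR₀ hκ hFB hq₀ hr.le h2r
  have h2π : (0 : ℝ) < 2 * π := by positivity
  refine ⟨?_, ?_, ?_, ?_, ?_⟩
  · exact intervalIntegral_pos_of_pos_on
      ((hcW.div hcG fun t => (hposG t).ne').intervalIntegrable _ _)
      (fun t _ => div_pos (hposW t) (hposG t)) h2π
  · exact intervalIntegral_pos_of_pos_on
      ((hcW.div (hcU.mul hcG) fun t => (mul_pos (hposU t) (hposG t)).ne').intervalIntegrable _ _)
      (fun t _ => div_pos (hposW t) (mul_pos (hposU t) (hposG t))) h2π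
  · exact intervalIntegral_pos_of_pos_on
      ((hcW.div hcU fun t => (hposU t).ne').intervalIntegrable _ _)
      (fun t _ => div_pos (hposW t) (hposU t)) h2π
  · exact intervalIntegral_pos_of_pos_on
      (((hcU.div (continuous_const.add hcG) fun t =>
        (by have := hposG t; positivity : 0 < g ^ 2 + lcGradSq κ FB R₀ q₀ r t).ne').mul
        hcW).intervalIntegrable _ _)
      (fun t _ => mul_pos (div_pos (hposU t) (by have := hposG t; positivity)) (hposW t)) h2π
  · exact intervalIntegral_pos_of_pos_on
      (((hcU.div ((continuous_const.add hcG).mul hcG) fun t =>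
        (by have := hposG t; positivity :
          0 < (g ^ 2 + lcGradSq κ FB R₀ q₀ r t) * lcGradSq κ FB R₀ q₀ r t).ne').mul
        hcW).intervalIntegrable _ _)
      (fun t _ => mul_pos (div_pos (hposU t) (by have := hposG t; positivity)) (hposW t)) h2π

end gstructure

end Literature.MathematicalPhysics.MHD.Solovev
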